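import Summits.NavierStokesRegularity.NavierStokesRegularity.Theorems.SwirlFreeBudgetEtaEnergyIdentity
import Summits.NavierStokesRegularity.NavierStokesRegularity.Theorems.SwirlFreeBudgetEtaAxisTerm
import Literature.Analysis.FluidPDE.Seregin2020SwirlMoserEnergyBound
import Literature.Analysis.FluidPDE.SobolevWholeSpace
import Literature.Analysis.FluidPDE.EnergyToolkit
import HarnessLib

/-!
# SwirlFreeBudget, crux K-18.1 `EtaMoserBound`, steps A.2–A.4: the energy inequality for
# `η = ω_θ/r` and the absorption of the drift with the scaled energy `A` only (seat nsreg-p4 g13)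

Support file for the DORMANT route `SwirlThreshold` (crux stmt-NavierStokesRegularity-2002) and
planner nsreg-p2's ROUND-18 Appendix A (`R18-APPENDIX-EtaMoser.md`, §A.2–A.4).

* `eta_energy_inequality` — (A.2)–(A.3), the `η`-twin of the tree's
  `Seregin2020.swirl_energy_inequality`: in the setting of `eta_energy_identity` (sibling
  `…SwirlFreeBudgetEtaEnergyIdentity`), with `H, H'' ≥ 0`, `H'² ≤ 2HH''`, axisymmetric slices
  `f s` and an axisymmetric cut-off `Θ` whose square has radial derivative quotient `q`
  (`x₀ q = ∂₀(Θ²)`), `χ ≥ 0`, `χ(t₁) = 0`: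
  `χ(t)M(t) + ½∫_{t₁}^t χ G_H ≤ ∫_{t₁}^t (4χP + χT_W − 2χT_q + |χ'|M) ds`
  with `M = ∫H(f)Θ²`, `G_H = ∫H''(f)|∇f|²Θ²`, `P = ∫H(f)|∇Θ|²`, `T_W = ∫H(f)⟪W,∇Θ²⟫`,
  `T_q = ∫H(f) q` — the cross term absorbed (`neg_cross_le_pointwise`), the axis term DROPPED by its
  sign (`integral_deriv_comp_mul_radDerivQuot_mul_le`: `2∫H'(f) q_f Θ² ≤ −2∫H(f) q`).
* `four_mul_mul_le_of_pow_four_le` — the Young step with exponents `(4, 4/3)` in polynomial form: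
  `P⁴ ≤ ΛY³ ⇒ 4BP ≤ δY + 27B⁴Λ/δ³` (certificate `a⁴ − 4a³b + 27b⁴ = (a − 3b)²(a² + 2ab + 3b²)`).
* `integral_pow_six_le_of_contDiff` — the Gagliardo–Nirenberg–Sobolev inequality `H¹ ⊂ L⁶(ℝ³)`
  in real form for `C¹_c` functions: `∫ g⁶ ≤ C_S⁶ (∫‖Dg‖²)³`.
* `eta_transport_slice_le` — **(A.4), CTZ22 (eqA.5) with `Γ ↦ η`: the drift term is absorbed with
  the `L²` norm of the drift only.**  For `Θ = ψ²` (`0 ≤ ψ ≤ 1`, `‖∇ψ‖ ≤ B`, `tsupport ψ ⊆ K`),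
  `H = s²` with `2s'² ≤ H''`, `s ≥ 0`, and a continuous drift `w`:
  `∫ H(F)⟪w, ∇Θ²⟫ ≤ δ(G_H + 2P) + 27 B⁴ C_S⁶ (∫_K‖w‖²)² (∫_K H(F)) / δ³`
  (pointwise `H⟪w,∇Θ²⟫ ≤ 4B‖w‖s(F)²ψ³ = 4B‖w‖·(Θs(F))·(ψs(F))`, Cauchy–Schwarz twice,
  Sobolev for `g = Θ s(F)`, `‖∇g‖² ≤ H''|∇F|²Θ² + 2H|∇Θ|²`, Young).

WHAT THIS IS NOT: not NS regularity — estimates for the smooth swirl-free class; `EtaMoserBound`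
stays OPEN here; no crux claim.
-/

-- the problem directory repeats the summit name (D-0017); core's `dupNamespace` linter fires
set_option linter.dupNamespace false

namespace Summit.NavierStokesRegularity.NavierStokesRegularity.Theorems.SwirlFreeBudget

open MeasureTheory Set Filter Topology Metric Function intervalIntegral
open scoped RealInnerProductSpace Laplacian ContDiff ENNReal NNReal
open Literature.Analysis Literature.Analysis.FluidPDE Literature.Analysis.FluidPDE.Seregin2020

noncomputable section

/-! ### The energy inequality -/

section Inequality

variable {W : ℝ → EuclideanSpace ℝ (Fin 3) → EuclideanSpace ℝ (Fin 3)}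
  {f : ℝ → EuclideanSpace ℝ (Fin 3) → ℝ} {lo hi : ℝ}

/-- **The energy inequality for `η`** (memo A.2–A.3; the `η`-twin of
`Seregin2020.swirl_energy_inequality`).  In the setting of `eta_energy_identity`, assume moreover
that the slices `f s` are axisymmetric, `H, H'' ≥ 0`, `H'² ≤ 2HH''`, the cut-off `Θ` is axisymmetric
and `q` is a continuous compactly supported axisymmetric scalar with `x₀ q = ∂₀(Θ²)`, `χ ≥ 0` and
`χ(t₁) = 0`, `lo < t₁ ≤ t < hi`.  Then
`χ(t) M(t) + ½ ∫_{t₁}^t χ G_H ≤ ∫_{t₁}^t (4 χ P + χ T_W − 2 χ T_q + |χ'| M) ds`,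
`M = ∫H(f)Θ²`, `G_H = ∫H''(f)|∇f|²Θ²`, `P = ∫H(f)|∇Θ|²`, `T_W = ∫H(f)⟪W,∇Θ²⟫`, `T_q = ∫H(f) q`
(the axis term `2∫H'(f) radDerivQuot f Θ² ≤ −2 T_q` by `integral_deriv_comp_mul_radDerivQuot_mul_le`). -/
theorem eta_energy_inequality
    (hf : ∀ τ ∈ Ioo lo hi, ContDiff ℝ 2 (f τ)) (hfax : ∀ τ ∈ Ioo lo hi, IsAxisymmetricScalar (f τ))
    (hW : ∀ τ ∈ Ioo lo hi, ContDiff ℝ 1 (W τ))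
    {U : Set (EuclideanSpace ℝ (Fin 3))}
    (hdiv : ∀ τ ∈ Ioo lo hi, ∀ x ∈ U, VectorCalculus.divergence (W τ) x = 0)
    (hfc : ContinuousOn (fun p : ℝ × EuclideanSpace ℝ (Fin 3) => f p.1 p.2) (Ioo lo hi ×ˢ univ))
    (hDc : ContinuousOn (fun p : ℝ × EuclideanSpace ℝ (Fin 3) => fderiv ℝ (f p.1) p.2) (Ioo lo hi ×ˢ univ))
    (hqfc : ContinuousOn (fun p : ℝ × EuclideanSpace ℝ (Fin 3) => radDerivQuot (f p.1) p.2) (Ioo lo hi ×ˢ univ))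
    (hWc : ContinuousOn (fun p : ℝ × EuclideanSpace ℝ (Fin 3) => W p.1 p.2) (Ioo lo hi ×ˢ univ))
    (hLc : ContinuousOn (fun p : ℝ × EuclideanSpace ℝ (Fin 3) =>
      (Δ (f p.1)) p.2 - fderiv ℝ (f p.1) p.2 (W p.1 p.2) + 2 * radDerivQuot (f p.1) p.2) (Ioo lo hi ×ˢ univ))
    (heq : ∀ x ∈ U, ∀ s ∈ Ioo lo hi, ∀ t ∈ Ioo lo hi, s ≤ t →
      f t x - f s x = ∫ τ in s..t, ((Δ (f τ)) x - fderiv ℝ (f τ) x (W τ x) + 2 * radDerivQuot (f τ) x))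
    {H : ℝ → ℝ} (hH : ContDiff ℝ 2 H) (hH0 : ∀ v, 0 ≤ H v) (hH2 : ∀ v, 0 ≤ deriv (deriv H) v)
    (hκ : ∀ v, deriv H v ^ 2 ≤ 2 * H v * deriv (deriv H) v)
    {Θ : EuclideanSpace ℝ (Fin 3) → ℝ} (hΘ : ContDiff ℝ 1 Θ) (hΘc : HasCompactSupport Θ)
    (hΘU : tsupport Θ ⊆ U) (hΘax : IsAxisymmetricScalar Θ)
    {q : EuclideanSpace ℝ (Fin 3) → ℝ} (hqc : Continuous q) (hqs : HasCompactSupport q)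
    (hqax : IsAxisymmetricScalar q)
    (hq : ∀ x : EuclideanSpace ℝ (Fin 3), x 0 * q x = fderiv ℝ (fun y => Θ y ^ 2) x (EuclideanSpace.single 0 1))
    {χ : ℝ → ℝ} (hχ : ContDiff ℝ 1 χ) (hχ0 : ∀ s, 0 ≤ χ s)
    {t₁ t : ℝ} (h1 : lo < t₁) (h1t : t₁ ≤ t) (ht : t < hi) (hχ1 : χ t₁ = 0)
    {M GH Pf TW Tq : ℝ → ℝ}
    (hM : ∀ s, M s = ∫ x, H (f s x) * Θ x ^ 2)
    (hGH : ∀ s, GH s = ∫ x, deriv (deriv H) (f s x) * ‖gradient (f s) x‖ ^ 2 * Θ x ^ 2)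
    (hPf : ∀ s, Pf s = ∫ x, H (f s x) * ‖gradient Θ x‖ ^ 2)
    (hTW : ∀ s, TW s = ∫ x, H (f s x) * ⟪W s x, gradient (fun y => Θ y ^ 2) x⟫)
    (hTq : ∀ s, Tq s = ∫ x, H (f s x) * q x) :
    χ t * M t + 1 / 2 * ∫ s in t₁..t, χ s * GH s ≤
      ∫ s in t₁..t, (4 * (χ s * Pf s) + χ s * TW s - 2 * (χ s * Tq s) + |deriv χ s| * M s) := by
  -- the two functionals not in the statement
  obtain ⟨T₁, hT₁⟩ : ∃ T₁ : ℝ → ℝ, ∀ s, T₁ s = ∫ x, deriv H (f s x) *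
      ⟪gradient (f s) x, gradient (fun y => Θ y ^ 2) x⟫ := ⟨_, fun _ => rfl⟩
  obtain ⟨Ta, hTa⟩ : ∃ Ta : ℝ → ℝ, ∀ s, Ta s = ∫ x, deriv H (f s x) * radDerivQuot (f s) x * Θ x ^ 2 :=
    ⟨_, fun _ => rfl⟩
  obtain ⟨cM, cGH, cT₁, cPf, cTW, cTa⟩ :=
    continuousOn_eta_sliceFunctionals hfc hDc hqfc hWc hH hΘ hΘc hM hGH hT₁ hPf hTW hTa
  set K : Set (EuclideanSpace ℝ (Fin 3)) := tsupport Θ with hKdef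
  have hK : IsCompact K := hΘc
  have hΘ0 : ∀ x, x ∉ K → Θ x = 0 := fun x hx => image_eq_zero_of_notMem_tsupport hx
  have hgΘ0 : ∀ x, x ∉ K → gradient (fun y => Θ y ^ 2) x = 0 := fun x hx => gradient_sq_eq_zero_of_notMem hx
  have hgΘ0' : ∀ x, x ∉ K → gradient Θ x = 0 := fun x hx => gradient_eq_zero_of_notMem_tsupport hx
  have hIcc : Icc t₁ t ⊆ Ioo lo hi := fun r hr => ⟨lt_of_lt_of_le h1 hr.1, lt_of_le_of_lt hr.2 ht⟩
  have hH1 : ContDiff ℝ 1 H := hH.of_le one_le_two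
  have hH' : ContDiff ℝ 1 (deriv H) := by
    have h2' : ContDiff ℝ (1 + 1) H := by rw [one_add_one_eq_two]; exact hH
    exact h2'.deriv'
  have hΘ2 : ContDiff ℝ 1 fun y => Θ y ^ 2 := hΘ.pow 2
  have hΘ2c : HasCompactSupport fun y => Θ y ^ 2 := HasCompactSupport.intro hK fun x hx => by simp [hΘ0 x hx]
  have hΘ2ax : IsAxisymmetricScalar fun y => Θ y ^ 2 := fun θ x => by simp only [hΘax θ x]
  -- continuity of `Tq`
  have cTq : ContinuousOn Tq (Ioo lo hi) := by
    have h := continuousOn_integral_slice_of_eq_zero (I := Ioo lo hi) isOpen_univ hqs (subset_univ _)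
      (Φ := fun z : ℝ × EuclideanSpace ℝ (Fin 3) => H (f z.1 z.2) * q z.2)
      ((hH.continuous.comp_continuousOn hfc).mul (hqc.comp continuous_snd).continuousOn)
      (fun s x hx => by simp [image_eq_zero_of_notMem_tsupport hx])
    exact h.congr fun s _ => hTq s
  -- (1) the identity on `[t₁, t]`
  have hid := eta_energy_identity hf hW hdiv hfc hLc heq hH hΘ hΘc hΘU hχ h1 h1t ht
  -- (2) its left-hand side is `χ(t) M(t)`
  have eL : ∫ x, (H (f t x) * χ t - H (f t₁ x) * χ t₁) * Θ x ^ 2 = χ t * M t := by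
    rw [hM t, ← MeasureTheory.integral_const_mul]
    refine integral_congr_ae (ae_of_all _ fun x => ?_)
    beta_reduce
    rw [hχ1]
    ring
  -- (3) slice facts for `s ∈ [t₁, t]`
  have hslice : ∀ s ∈ Icc t₁ t,
      (∫ x, (deriv (deriv H) (f s x) * ‖gradient (f s) x‖ ^ 2 * Θ x ^ 2 +
        deriv H (f s x) * ⟪gradient (f s) x, gradient (fun y => Θ y ^ 2) x⟫)) = GH s + T₁ s ∧
      -T₁ s ≤ GH s / 2 + 4 * Pf s ∧ Ta s ≤ -Tq s ∧ 0 ≤ M s := by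
    intro s hs
    have hsI : s ∈ Ioo lo hi := hIcc hs
    have hF2 : ContDiff ℝ 2 (f s) := hf s hsI
    have hF1 : ContDiff ℝ 1 (f s) := hF2.of_le one_le_two
    have cF : Continuous (f s) := hF2.continuous
    have cgF : Continuous (gradient (f s)) := continuous_gradient_of_contDiff hF1
    have cΘ2 : Continuous fun y : EuclideanSpace ℝ (Fin 3) => Θ y ^ 2 := hΘ.continuous.pow 2
    have cgΘ : Continuous (gradient Θ) := continuous_gradient_of_contDiff hΘ
    have cgΘ2 : Continuous (gradient fun y => Θ y ^ 2) := continuous_gradient_of_contDiff hΘ2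
    have hsupp : ∀ {g : EuclideanSpace ℝ (Fin 3) → ℝ}, Continuous g → (∀ x, x ∉ K → g x = 0) →
        Integrable g := fun hg h0 => hg.integrable_of_hasCompactSupport (HasCompactSupport.intro hK h0)
    have iGH : Integrable fun x => deriv (deriv H) (f s x) * ‖gradient (f s) x‖ ^ 2 * Θ x ^ 2 :=
      hsupp ((((hH'.continuous_deriv le_rfl).comp cF).mul (cgF.norm.pow 2)).mul cΘ2)
        (fun x hx => by simp [hΘ0 x hx])
    have iT₁ : Integrable fun x => deriv H (f s x) * ⟪gradient (f s) x, gradient (fun y => Θ y ^ 2) x⟫ :=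
      hsupp ((hH'.continuous.comp cF).mul (cgF.inner cgΘ2)) (fun x hx => by
          show deriv H (f s x) * ⟪gradient (f s) x, gradient (fun y => Θ y ^ 2) x⟫ = 0
          rw [hgΘ0 x hx, inner_zero_right, mul_zero])
    have iPf : Integrable fun x => H (f s x) * ‖gradient Θ x‖ ^ 2 :=
      hsupp ((hH.continuous.comp cF).mul (cgΘ.norm.pow 2)) (fun x hx => by simp [hgΘ0' x hx])
    have iTa : Integrable fun x => deriv H (f s x) * radDerivQuot (f s) x * Θ x ^ 2 :=
      hsupp (((hH'.continuous.comp cF).mul (continuous_radDerivQuot hF2)).mul cΘ2)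
        (fun x hx => by simp [hΘ0 x hx])
    have iTq : Integrable fun x => H (f s x) * q x :=
      ((hH.continuous.comp cF).mul hqc).integrable_of_hasCompactSupport hqs.mul_left
    refine ⟨?_, ?_, ?_, ?_⟩
    · rw [hGH s, hT₁ s, ← integral_add iGH iT₁]
    · rw [hT₁ s, hGH s, hPf s, ← MeasureTheory.integral_neg, ← MeasureTheory.integral_div,
        ← MeasureTheory.integral_const_mul,
        ← integral_add (iGH.div_const _) (iPf.const_mul _)]
      refine integral_mono iT₁.neg ((iGH.div_const _).add (iPf.const_mul _)) fun x => ?_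
      exact neg_cross_le_pointwise hH0 hH2 hκ hΘ (f s) x
    · rw [hTa s, hTq s]
      exact integral_deriv_comp_mul_radDerivQuot_mul_le hF2 (hfax s hsI) hH1 hH0 hΘ2 hΘ2c
        (fun x => sq_nonneg _) hΘ2ax hqax hq iTa iTq
    · rw [hM s]
      exact integral_nonneg fun x => mul_nonneg (hH0 _) (sq_nonneg _)
  -- (4) interval integrability on `[t₁, t]`
  have hsub : uIcc t₁ t ⊆ Ioo lo hi := by
    rw [uIcc_of_le h1t]
    exact hIcc
  have iiM : IntervalIntegrable M volume t₁ t := (cM.mono hsub).intervalIntegrable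
  have iiGH : IntervalIntegrable GH volume t₁ t := (cGH.mono hsub).intervalIntegrable
  have iiT₁ : IntervalIntegrable T₁ volume t₁ t := (cT₁.mono hsub).intervalIntegrable
  have iiPf : IntervalIntegrable Pf volume t₁ t := (cPf.mono hsub).intervalIntegrable
  have iiTW : IntervalIntegrable TW volume t₁ t := (cTW.mono hsub).intervalIntegrable
  have iiTa : IntervalIntegrable Ta volume t₁ t := (cTa.mono hsub).intervalIntegrable
  have iiTq : IntervalIntegrable Tq volume t₁ t := (cTq.mono hsub).intervalIntegrable
  have cχ : Continuous χ := hχ.continuous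
  have cχ' : Continuous (deriv χ) := hχ.continuous_deriv le_rfl
  have iiχ : ∀ {g : ℝ → ℝ}, IntervalIntegrable g volume t₁ t → IntervalIntegrable (fun s => χ s * g s) volume t₁ t :=
    fun hg => hg.continuousOn_mul cχ.continuousOn
  -- (5) the identity's integrand, rewritten, and its majorant
  have eI : ∀ s ∈ Icc t₁ t, χ s *
        (-(∫ x, (deriv (deriv H) (f s x) * ‖gradient (f s) x‖ ^ 2 * Θ x ^ 2 +
            deriv H (f s x) * ⟪gradient (f s) x, gradient (fun y => Θ y ^ 2) x⟫)) +
          (∫ x, H (f s x) * ⟪W s x, gradient (fun y => Θ y ^ 2) x⟫) +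
          2 * ∫ x, deriv H (f s x) * radDerivQuot (f s) x * Θ x ^ 2) +
        deriv χ s * ∫ x, H (f s x) * Θ x ^ 2 =
      -(χ s * GH s) - χ s * T₁ s + χ s * TW s + 2 * (χ s * Ta s) + deriv χ s * M s := by
    intro s hs
    rw [(hslice s hs).1, ← hTW s, ← hTa s, ← hM s]
    ring
  have hmaj : ∀ s ∈ Icc t₁ t,
      -(χ s * GH s) - χ s * T₁ s + χ s * TW s + 2 * (χ s * Ta s) + deriv χ s * M s ≤
        -(1 / 2) * (χ s * GH s) +
          (4 * (χ s * Pf s) + χ s * TW s - 2 * (χ s * Tq s) + |deriv χ s| * M s) := by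
    intro s hs
    obtain ⟨-, hcross, hax, hM0⟩ := hslice s hs
    have h1 : -(χ s * T₁ s) ≤ χ s * (GH s / 2 + 4 * Pf s) := by
      have := mul_le_mul_of_nonneg_left hcross (hχ0 s)
      linarith
    have h2 : deriv χ s * M s ≤ |deriv χ s| * M s := mul_le_mul_of_nonneg_right (le_abs_self _) hM0
    have h3 : χ s * Ta s ≤ -(χ s * Tq s) := by
      have := mul_le_mul_of_nonneg_left hax (hχ0 s)
      linarith
    nlinarith [h1, h2, h3]
  -- (6) integrate
  have iLHS : IntervalIntegrable (fun s => -(χ s * GH s) - χ s * T₁ s + χ s * TW s + 2 * (χ s * Ta s) +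
      deriv χ s * M s) volume t₁ t :=
    ((((iiχ iiGH).neg.sub (iiχ iiT₁)).add (iiχ iiTW)).add ((iiχ iiTa).const_mul 2)).add
      (iiM.continuousOn_mul cχ'.continuousOn)
  have iRHS₂ : IntervalIntegrable (fun s => 4 * (χ s * Pf s) + χ s * TW s - 2 * (χ s * Tq s) +
      |deriv χ s| * M s) volume t₁ t :=
    ((((iiχ iiPf).const_mul 4).add (iiχ iiTW)).sub ((iiχ iiTq).const_mul 2)).add
      (iiM.continuousOn_mul cχ'.abs.continuousOn)
  have iRHS : IntervalIntegrable (fun s => -(1 / 2) * (χ s * GH s) +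
      (4 * (χ s * Pf s) + χ s * TW s - 2 * (χ s * Tq s) + |deriv χ s| * M s)) volume t₁ t :=
    ((iiχ iiGH).const_mul _).add iRHS₂
  have hint_id : ∫ s in t₁..t, (χ s *
        (-(∫ x, (deriv (deriv H) (f s x) * ‖gradient (f s) x‖ ^ 2 * Θ x ^ 2 +
            deriv H (f s x) * ⟪gradient (f s) x, gradient (fun y => Θ y ^ 2) x⟫)) +
          (∫ x, H (f s x) * ⟪W s x, gradient (fun y => Θ y ^ 2) x⟫) +
          2 * ∫ x, deriv H (f s x) * radDerivQuot (f s) x * Θ x ^ 2) +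
        deriv χ s * ∫ x, H (f s x) * Θ x ^ 2) =
      ∫ s in t₁..t, (-(χ s * GH s) - χ s * T₁ s + χ s * TW s + 2 * (χ s * Ta s) + deriv χ s * M s) := by
    refine intervalIntegral.integral_congr fun s hs => ?_
    rw [uIcc_of_le h1t] at hs
    exact eI s hs
  have hmono : ∫ s in t₁..t, (-(χ s * GH s) - χ s * T₁ s + χ s * TW s + 2 * (χ s * Ta s) + deriv χ s * M s) ≤
      ∫ s in t₁..t, (-(1 / 2) * (χ s * GH s) +
        (4 * (χ s * Pf s) + χ s * TW s - 2 * (χ s * Tq s) + |deriv χ s| * M s)) :=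
    intervalIntegral.integral_mono_on h1t iLHS iRHS hmaj
  have hsplit : ∫ s in t₁..t, (-(1 / 2) * (χ s * GH s) +
        (4 * (χ s * Pf s) + χ s * TW s - 2 * (χ s * Tq s) + |deriv χ s| * M s)) =
      -(1 / 2) * (∫ s in t₁..t, χ s * GH s) +
        ∫ s in t₁..t, (4 * (χ s * Pf s) + χ s * TW s - 2 * (χ s * Tq s) + |deriv χ s| * M s) := by
    rw [intervalIntegral.integral_add ((iiχ iiGH).const_mul _) iRHS₂, intervalIntegral.integral_const_mul]
  have hmain : χ t * M t = ∫ s in t₁..t, (-(χ s * GH s) - χ s * T₁ s + χ s * TW s + 2 * (χ s * Ta s) +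
      deriv χ s * M s) := by
    rw [← eL, hid, hint_id]
  rw [hsplit] at hmono
  linarith [hmono, hmain]

end Inequality

end

end Summit.NavierStokesRegularity.NavierStokesRegularity.Theorems.SwirlFreeBudget
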